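import Summits.FinalStateConjecture.FinalStateConjecture.Theorems.ClusterCompletenessAdiabaticMultiKerrILEDWeightedTCurrent
import Summits.FinalStateConjecture.FinalStateConjecture.Theorems.ClusterCompletenessAdiabaticMultiKerrILEDHardyCurrent
import Summits.FinalStateConjecture.FinalStateConjecture.Theorems.ClusterCompletenessAdiabaticMultiKerrILEDQuadraticDecomposition
import Summits.FinalStateConjecture.FinalStateConjecture.Theorems.ClusterCompletenessAdiabaticMultiKerrILEDMorawetzWeight

/-!
# Route ClusterCompleteness — crux `AdiabaticMultiKerrILED`, line `Sketch`:
# the horizon-layer term of the weighted Morawetz identity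

Helper file for the crux `stmt-FinalStateConjecture-14310`
(`Summit.FinalStateConjecture.FinalStateConjecture.Theses.ClusterCompleteness.AdiabaticMultiKerrILED`),
line `Sketch`, stub `morawetz_horizonLayer_lower` (lead c7, wave 5, Morawetz integration).

Setting: the rest-frame tails-cut zero-spin zone `G₀ = η⁻¹ − μ ℓ♯ ⊗ ℓ♯`
(`KerrSchild.inverseMetric` with profile `μ(y) = χ(2 − r/8M) · 2H`, `ℓ♯ = Kerr.nullVector 0 = (−1, x⃗/r)`),
the total Morawetz current `J_tot = J^X + ¼ L^{ϖ₂} + J_H + J^T` (radial multiplier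
`X = F ∂_{r*}`, `F = 1 − 3M/r`, `∂_{r*} = μ ∂₀ + f x⃗/r · ∇`, `f = 1 − μ`; Lagrangian weight
`ϖ₂(r) = 2 f · g(r)`, `g = (2r − 3M)/r² − M³(r − 3M)²/r⁶`; Hardy current `½ ŷ(r) Φ² ∂_{r*}`; Killing
current `J^T`), and the receding horizon factor `W = χ(u₂/ε − 1)`, `u₂ = Kerr.horizonFn M 0`.

`morawetz_horizonLayer_lower`: at a point with `2M < r ≤ 3M` (where `μ = 2M/r` exactly),
`∑_μ ∂_μW · J_tot^μ ≥ −f · K · ‖dW‖ · (∑_μ (∂_μΦ)² + Φ²/M²)` with `K = 4`. Proof: `dW = −k ν`,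
`ν = (s, −x⃗/r)`, `s = (r − 2M)/2M`, `k = χ' e^{−x⁰/2M}/ε ≥ 0`, and the two exact relations
`μ s = f`, `|x⃗/r| = 1` give `G₀ dW = k (s + 1) ∂₀`, `dW(∂_{r*}) = 0`, `dW(X) = 0`; hence
`∑ ∂W · J_tot = (1 + Fμ) ∑ ∂W · J^T + k f [F ((s+1) ∂₀Φ ∂_rΦ − ½ G₀(dΦ,dΦ)) + ½ g Φ (s+1) ∂₀Φ]`
(a polynomial identity, `horizonLayer_sum_eq`). The first term is `≥ 0` by the landed dominant energy
condition `sum_fderiv_horizonFactor_mul_multiplierCurrent_timeField_nonneg` and `1 + Fμ ≥ ½`; the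
bracket is bounded by `2 (∑ (∂Φ)² + Φ²/M²)` (`|F| ≤ ½`, `s + 1 ≤ 3/2`, `|2Mg| ≤ 1`, Cauchy–Schwarz;
`horizonLayer_real_bound`), and `k ≤ 2 ‖dW‖` since `k² = ∑ᵢ (∂ᵢW)²`. Dafermos–Rodnianski
arXiv:0811.0354, §4.1 (degenerate Morawetz estimate on Schwarzschild); DRSR arXiv:1402.7034, §2.3.2
(boundary terms). [folklore]
-/

noncomputable section

-- the doubled `FinalStateConjecture.FinalStateConjecture` path component trips dupNamespace
set_option linter.dupNamespace false

open Set Filter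
open scoped BigOperators Topology
open Literature.Geometry.Lorentzian

namespace Summit.FinalStateConjecture.FinalStateConjecture.Theorems

/-! ### Small bricks -/

/-- `χ' ≥ 0` (`χ = Real.smoothTransition` is monotone). [folklore] -/
private theorem horizonLayer_deriv_smoothTransition_nonneg (s : ℝ) :
    0 ≤ deriv Real.smoothTransition s :=
  Real.smoothTransition.monotone.deriv_nonneg

/-- `χ` is differentiable, with derivative `χ'`. [folklore] -/
private theorem horizonLayer_hasDerivAt_smoothTransition (s : ℝ) :
    HasDerivAt Real.smoothTransition (deriv Real.smoothTransition s) s :=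
  ((Real.smoothTransition.contDiffAt (n := 1)).differentiableAt (by simp)).hasDerivAt

/-- `‖∂_μ‖ = 1` in `E4`. [folklore] -/
private theorem horizonLayer_norm_basisVector (μ : Fin 4) : ‖E4.basisVector μ‖ = 1 := by
  simp [E4.basisVector]

/-- For `a = 0` the spatial gradient of the Kerr–Schild radius is `∇r = x⃗/r` off the time axis
(`r = ‖x⃗‖`, `Σ = r²`). [folklore] -/
theorem horizonLayer_radiusGradVec_zero {x : E4} (hx : 0 < Kerr.radius 0 x) (i : Fin 3) :
    Kerr.radiusGradVec 0 (E4.spatial x) i = x i.succ / Kerr.radius 0 x := by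
  have hr : Kerr.radius 0 x ≠ 0 := hx.ne'
  rw [Kerr.radiusGradVec_apply, Kerr.radius_ofTimeSpace_spatial, Kerr.blSigma_spatial_eq,
    ← Kerr.radius_zero_left, E4.spatial_apply]
  simp only [ne_eq, OfNat.ofNat_ne_zero, not_false_eq_true, zero_pow, zero_mul, ite_self, add_zero]
  rw [show 2 * Kerr.radius 0 x ^ 2 - Kerr.radius 0 x ^ 2 = Kerr.radius 0 x ^ 2 by ring,
    div_eq_div_iff (by positivity) hr]
  ring

/-! ### The elementary lower bound for the `f`-small remainder -/

/-- **Elementary bound.** For `k ∈ [0, 2N]`, `m ∈ [0, 1]`, `s ∈ [0, ½]`, `F ∈ [−½, 0]`, `2Mg ∈ [−1, 1]`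
(`M > 0`) and a unit vector `n`, the remainder
`k (1 − m) [F ((s+1) p₀ (n·p⃗) − ½ Q) ] + ½ (1 − m) g w₀ k (s+1) p₀`,
`Q = −p₀² + |p⃗|² − m (n·p⃗ − p₀)²`, is `≥ −(1 − m) · 4N · (∑ p_μ² + w₀²/M²)`
(Cauchy–Schwarz `(n·p⃗)² ≤ |p⃗|²`, `|Q| ≤ 3 ∑ p_μ²`, and `2ab ≤ a² + b²`). [folklore] -/
theorem horizonLayer_real_bound {k N m s F g M w₀ p₀ p₁ p₂ p₃ n₁ n₂ n₃ : ℝ} (hM : 0 < M)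
    (hk0 : 0 ≤ k) (hkN : k ≤ 2 * N) (hm0 : 0 ≤ m) (hm1 : m ≤ 1) (hs0 : 0 ≤ s) (hs1 : s ≤ 2⁻¹)
    (hF0 : F ≤ 0) (hF1 : -2⁻¹ ≤ F) (hg1 : 2 * M * g ≤ 1) (hg2 : -1 ≤ 2 * M * g)
    (hn : n₁ ^ 2 + n₂ ^ 2 + n₃ ^ 2 = 1) :
    -((1 - m) * 4 * N * (p₀ ^ 2 + p₁ ^ 2 + p₂ ^ 2 + p₃ ^ 2 + w₀ ^ 2 / M ^ 2)) ≤
      k * (1 - m) * (F * ((s + 1) * p₀ * (n₁ * p₁ + n₂ * p₂ + n₃ * p₃) -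
          2⁻¹ * (-p₀ ^ 2 + p₁ ^ 2 + p₂ ^ 2 + p₃ ^ 2 - m * (n₁ * p₁ + n₂ * p₂ + n₃ * p₃ - p₀) ^ 2))) +
        2⁻¹ * (1 - m) * g * w₀ * k * (s + 1) * p₀ := by
  -- rescale `w₀ = M z`
  obtain ⟨z, hz⟩ : ∃ z : ℝ, w₀ = M * z := ⟨w₀ / M, (mul_div_cancel₀ w₀ hM.ne').symm⟩
  have hz2 : w₀ ^ 2 / M ^ 2 = z ^ 2 := by
    rw [hz, mul_pow, mul_div_cancel_left₀ _ (pow_ne_zero 2 hM.ne')]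
  rw [hz2, hz]
  -- Cauchy–Schwarz for the radial derivative
  have hP3 : 0 ≤ p₁ ^ 2 + p₂ ^ 2 + p₃ ^ 2 := by positivity
  have hpr : (n₁ * p₁ + n₂ * p₂ + n₃ * p₃) ^ 2 ≤ p₁ ^ 2 + p₂ ^ 2 + p₃ ^ 2 := by
    have hlag : (p₁ ^ 2 + p₂ ^ 2 + p₃ ^ 2) * (n₁ ^ 2 + n₂ ^ 2 + n₃ ^ 2) -
        (n₁ * p₁ + n₂ * p₂ + n₃ * p₃) ^ 2 = (n₁ * p₂ - n₂ * p₁) ^ 2 +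
          (n₁ * p₃ - n₃ * p₁) ^ 2 + (n₂ * p₃ - n₃ * p₂) ^ 2 := by ring
    rw [hn, mul_one] at hlag
    linarith only [hlag, sq_nonneg (n₁ * p₂ - n₂ * p₁), sq_nonneg (n₁ * p₃ - n₃ * p₁),
      sq_nonneg (n₂ * p₃ - n₃ * p₂)]
  generalize n₁ * p₁ + n₂ * p₂ + n₃ * p₃ = P at hpr ⊢
  -- `|Q| ≤ 3 ∑ p²`
  have hQ1 : -p₀ ^ 2 + p₁ ^ 2 + p₂ ^ 2 + p₃ ^ 2 - m * (P - p₀) ^ 2 ≤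
      3 * (p₀ ^ 2 + p₁ ^ 2 + p₂ ^ 2 + p₃ ^ 2) := by
    linarith only [mul_nonneg hm0 (sq_nonneg (P - p₀)), sq_nonneg p₀, hP3]
  have hQ2 : -(3 * (p₀ ^ 2 + p₁ ^ 2 + p₂ ^ 2 + p₃ ^ 2)) ≤
      -p₀ ^ 2 + p₁ ^ 2 + p₂ ^ 2 + p₃ ^ 2 - m * (P - p₀) ^ 2 := by
    linarith only [mul_le_of_le_one_left (sq_nonneg (P - p₀)) hm1, sq_nonneg (P + p₀), sq_nonneg p₀,
      hpr, hP3]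
  generalize -p₀ ^ 2 + p₁ ^ 2 + p₂ ^ 2 + p₃ ^ 2 - m * (P - p₀) ^ 2 = Q at hQ1 hQ2 ⊢
  -- the three pieces of the bracket
  have hs0' : 0 ≤ s + 1 := by linarith
  have hB1 : -(3 / 8 * (p₀ ^ 2 + P ^ 2)) ≤ F * ((s + 1) * p₀ * P) := by
    have ha : -(3 / 4) ≤ F * (s + 1) := by
      linarith only [mul_nonneg (by linarith only [hF1] : (0 : ℝ) ≤ F + 2⁻¹) hs0', hs1]
    have ha' : F * (s + 1) ≤ 0 := mul_nonpos_of_nonpos_of_nonneg hF0 hs0'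
    linarith only [mul_nonneg (by linarith only [ha] : (0 : ℝ) ≤ F * (s + 1) + 3 / 4)
        (sq_nonneg (p₀ + P)),
      mul_nonneg (by linarith only [ha'] : (0 : ℝ) ≤ 3 / 4 - F * (s + 1)) (sq_nonneg (p₀ - P))]
  have hB2 : F * Q ≤ 3 / 2 * (p₀ ^ 2 + p₁ ^ 2 + p₂ ^ 2 + p₃ ^ 2) := by
    have hQ3 : 0 ≤ Q + 3 * (p₀ ^ 2 + p₁ ^ 2 + p₂ ^ 2 + p₃ ^ 2) := by linarith only [hQ2]
    linarith only [mul_nonneg (neg_nonneg.2 hF0) hQ3,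
      mul_nonneg (by linarith only [hF1] : (0 : ℝ) ≤ F + 2⁻¹)
        (by positivity : (0 : ℝ) ≤ p₀ ^ 2 + p₁ ^ 2 + p₂ ^ 2 + p₃ ^ 2)]
  have hc1 : M * g * (s + 1) ≤ 3 / 4 := by
    linarith only [mul_le_mul_of_nonneg_right hg1 hs0', hs1]
  have hc2 : -(3 / 4) ≤ M * g * (s + 1) := by
    linarith only [mul_le_mul_of_nonneg_right hg2 hs0', hs1]
  have hB3 : -(3 / 16 * (z ^ 2 + p₀ ^ 2)) ≤ 2⁻¹ * g * (M * z) * (s + 1) * p₀ := by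
    linarith only [mul_nonneg (by linarith only [hc2] : (0 : ℝ) ≤ 3 / 32 + M * g * (s + 1) / 8)
        (sq_nonneg (z + p₀)),
      mul_nonneg (by linarith only [hc1] : (0 : ℝ) ≤ 3 / 32 - M * g * (s + 1) / 8)
        (sq_nonneg (z - p₀))]
  have hB : -(2 * (p₀ ^ 2 + p₁ ^ 2 + p₂ ^ 2 + p₃ ^ 2 + z ^ 2)) ≤
      F * ((s + 1) * p₀ * P - 2⁻¹ * Q) + 2⁻¹ * g * (M * z) * (s + 1) * p₀ := by
    linarith only [hB1, hB2, hB3, hpr, hP3, sq_nonneg p₀, sq_nonneg z]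
  -- multiply by `k (1 − m) ∈ [0, 2N (1 − m)]`
  have hkm : 0 ≤ k * (1 - m) := mul_nonneg hk0 (sub_nonneg.2 hm1)
  have hS0 : 0 ≤ p₀ ^ 2 + p₁ ^ 2 + p₂ ^ 2 + p₃ ^ 2 + z ^ 2 := by positivity
  have h1 := mul_le_mul_of_nonneg_left hB hkm
  have h2 : k * (1 - m) * (p₀ ^ 2 + p₁ ^ 2 + p₂ ^ 2 + p₃ ^ 2 + z ^ 2) ≤
      2 * N * (1 - m) * (p₀ ^ 2 + p₁ ^ 2 + p₂ ^ 2 + p₃ ^ 2 + z ^ 2) :=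
    mul_le_mul_of_nonneg_right (mul_le_mul_of_nonneg_right hkN (sub_nonneg.2 hm1)) hS0
  linarith only [h1, h2]

/-! ### The exact cancellations: a polynomial identity -/

/-- **The horizon-layer identity.** For a Kerr–Schild-form field `G = η⁻¹ − φ l ⊗ l` with, at the
point `x`, `l = (−1, n)`, `|n| = 1`, `φ = m`, the multiplier `X = F (m ∂₀ + (1 − m) n·∇)`, the
tortoise vector `R = (m, (1 − m) n)`, a weight `ϖ` with `ϖ(x) = 2(1 − m) g` and `∂₀ϖ(x) = 0`, and a
coefficient covector `c = −k (s, −n)` with `m s = 1 − m`: the pairing of `c` with the total current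
`J^X + ¼ L^ϖ + ½ Y w² R + J^T` equals
`(1 + F m) ∑ c_μ (J^T)^μ + k (1 − m) [F ((s+1) p₀ (n·p⃗) − ½ Q)] + ½ (1 − m) g w k (s+1) p₀`,
`Q = −p₀² + |p⃗|² − m (n·p⃗ − p₀)²` (`G c = k(s+1) ∂₀`, `c(R) = c(X) = 0`; pure algebra, the two
relations enter through `linear_combination`). [folklore] -/
theorem horizonLayer_sum_eq (φ ϖ w : E4 → ℝ) (l : E4 → E4) (X : E4 → Fin 4 → ℝ) (x : E4)
    (c p q R : Fin 4 → ℝ) {k s m F g Y n₁ n₂ n₃ : ℝ}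
    (hp : ∀ β, fderiv ℝ w x (E4.basisVector β) = p β)
    (hq : ∀ β, fderiv ℝ ϖ x (E4.basisVector β) = q β) (hq0 : q 0 = 0)
    (hl0 : l x 0 = -1) (hl1 : l x 1 = n₁) (hl2 : l x 2 = n₂) (hl3 : l x 3 = n₃)
    (hn : n₁ ^ 2 + n₂ ^ 2 + n₃ ^ 2 = 1) (hφ : φ x = m) (hms : m * s = 1 - m)
    (hϖ : ϖ x = 2 * ((1 - m) * g))
    (hX0 : X x 0 = F * m) (hX1 : X x 1 = F * (1 - m) * n₁) (hX2 : X x 2 = F * (1 - m) * n₂)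
    (hX3 : X x 3 = F * (1 - m) * n₃)
    (hR0 : R 0 = m) (hR1 : R 1 = (1 - m) * n₁) (hR2 : R 2 = (1 - m) * n₂)
    (hR3 : R 3 = (1 - m) * n₃)
    (hc0 : c 0 = -(k * s)) (hc1 : c 1 = k * n₁) (hc2 : c 2 = k * n₂) (hc3 : c 3 = k * n₃) :
    ∑ μ, c μ * (KerrSchild.multiplierCurrent (KerrSchild.inverseMetric φ l) X w x μ +
        4⁻¹ * KerrSchild.lagrangianCurrent (KerrSchild.inverseMetric φ l) ϖ w x μ +
        2⁻¹ * Y * w x ^ 2 * R μ +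
        KerrSchild.multiplierCurrent (KerrSchild.inverseMetric φ l) KerrSchild.timeField w x μ) =
      (1 + F * m) * ∑ μ, c μ * KerrSchild.multiplierCurrent (KerrSchild.inverseMetric φ l)
          KerrSchild.timeField w x μ +
        (k * (1 - m) * (F * ((s + 1) * p 0 * (n₁ * p 1 + n₂ * p 2 + n₃ * p 3) -
            2⁻¹ * (-p 0 ^ 2 + p 1 ^ 2 + p 2 ^ 2 + p 3 ^ 2 -
              m * (n₁ * p 1 + n₂ * p 2 + n₃ * p 3 - p 0) ^ 2))) +
          2⁻¹ * (1 - m) * g * w x * k * (s + 1) * p 0) := by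
  simp only [KerrSchild.multiplierCurrent, KerrSchild.lagrangianCurrent, KerrSchild.inverseMetric,
    KerrSchild.timeField, Kerr.etaComp, Fin.sum_univ_four, Fin.isValue, hp, hq, hq0, hl0, hl1, hl2,
    hl3, hφ, hϖ, hX0, hX1, hX2, hX3, hR0, hR1, hR2, hR3, hc0, hc1, hc2, hc3]
  simp only [show (1 : Fin 4) ≠ 0 from by decide, show (2 : Fin 4) ≠ 0 from by decide,
    show (3 : Fin 4) ≠ 0 from by decide, show (0 : Fin 4) ≠ 1 from by decide,
    show (0 : Fin 4) ≠ 2 from by decide, show (0 : Fin 4) ≠ 3 from by decide,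
    show (1 : Fin 4) ≠ 2 from by decide, show (1 : Fin 4) ≠ 3 from by decide,
    show (2 : Fin 4) ≠ 1 from by decide, show (2 : Fin 4) ≠ 3 from by decide,
    show (3 : Fin 4) ≠ 1 from by decide, show (3 : Fin 4) ≠ 2 from by decide, if_true, if_false]
  linear_combination
    (m * (k * (p 0 - (n₁ * p 1 + n₂ * p 2 + n₃ * p 3)) *
        (F * (1 - m) * (n₁ * p 1 + n₂ * p 2 + n₃ * p 3) + 2⁻¹ * (1 - m) * g * w x)) +
      8⁻¹ * m * w x ^ 2 * k * (n₁ * q 1 + n₂ * q 2 + n₃ * q 3) -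
      2⁻¹ * k * F * (1 - m) * (-p 0 ^ 2 + p 1 ^ 2 + p 2 ^ 2 + p 3 ^ 2 -
        m * (n₁ * p 1 + n₂ * p 2 + n₃ * p 3 - p 0) ^ 2) +
      2⁻¹ * Y * w x ^ 2 * k * (1 - m)) * hn +
    (k * (p 0 - (n₁ * p 1 + n₂ * p 2 + n₃ * p 3)) *
        (F * (1 - m) * (n₁ * p 1 + n₂ * p 2 + n₃ * p 3) + 2⁻¹ * (1 - m) * g * w x) +
      8⁻¹ * w x ^ 2 * k * (n₁ * q 1 + n₂ * q 2 + n₃ * q 3) -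
      2⁻¹ * Y * w x ^ 2 * k) * hms

/-! ### The registered stub -/

/-- **The horizon-layer term of the weighted Morawetz identity is `O(f)`-small from below.**
For `M > 0` there is `K ≥ 0` (`K = 4`) such that at every point with `2M < r ≤ 3M` of the rest-frame
tails-cut zero-spin zone, for every `ε > 0` and every `Φ`,
`−f(x) · K · ‖dW(x)‖ · (∑_μ (∂_μΦ)² + Φ²/M²) ≤ ∑_μ ∂_μW (J^X + ¼ L^{ϖ₂} + J_H + J^T)^μ`,
`W = χ(u₂/ε − 1)`, `f = 1 − μ(x)`. With `dW = −k (s dt* − dr)`, `k ≥ 0`, `s = (r − 2M)/(2M)` and the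
exact relations `μ s = f`, `|∇r| = 1`: `G₀ dW = k(s+1) ∂₀`, `dW(∂_{r*}) = dW(X) = 0`, so the sum equals
`(1 + Fμ) ∑ ∂W · J^T + k f [F((s+1) ∂₀Φ ∂_rΦ − ½ G₀(dΦ,dΦ)) + ½ g Φ (s+1) ∂₀Φ]`
(`horizonLayer_sum_eq`); the first term is `≥ 0` (dominant energy condition,
`sum_fderiv_horizonFactor_mul_multiplierCurrent_timeField_nonneg`, `1 + Fμ ≥ ½`), the bracket is
`≥ −2(∑(∂Φ)² + Φ²/M²)` and `k ≤ 2‖dW‖` (`horizonLayer_real_bound`). Dafermos–Rodnianski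
arXiv:0811.0354, §4.1; DRSR arXiv:1402.7034, §2.3.2. [folklore] -/
theorem morawetz_horizonLayer_lower : ∀ (M : ℝ), 0 < M → ∃ K : ℝ, 0 ≤ K ∧ ∀ (ε : ℝ) (Φ : E4 → ℝ) (x : E4), 0 < ε → 2 * M < Kerr.radius 0 x → Kerr.radius 0 x ≤ 3 * M → -((1 - (Real.smoothTransition (2 - Kerr.radius 0 x / (8 * M)) * (2 * Kerr.scalarH M 0 x))) * K * ‖fderiv ℝ (fun y ↦ Real.smoothTransition (Kerr.horizonFn M 0 y / ε - 1)) x‖ * (∑ μ, fderiv ℝ Φ x (E4.basisVector μ) ^ 2 + Φ x ^ 2 / M ^ 2)) ≤ ∑ μ, fderiv ℝ (fun y ↦ Real.smoothTransition (Kerr.horizonFn M 0 y / ε - 1)) x (E4.basisVector μ) * (KerrSchild.multiplierCurrent (KerrSchild.inverseMetric (fun y ↦ Real.smoothTransition (2 - Kerr.radius 0 y / (8 * M)) * (2 * Kerr.scalarH M 0 y)) (Kerr.nullVector 0)) (fun (z : E4) (α : Fin 4) ↦ if α = 0 then (1 - 3 * M / Kerr.radius 0 z) * (Real.smoothTransition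 (2 - Kerr.radius 0 z / (8 * M)) * (2 * Kerr.scalarH M 0 z)) else (1 - 3 * M / Kerr.radius 0 z) * (1 - (Real.smoothTransition (2 - Kerr.radius 0 z / (8 * M)) * (2 * Kerr.scalarH M 0 z))) * z α / Kerr.radius 0 z) Φ x μ + 4⁻¹ * KerrSchild.lagrangianCurrent (KerrSchild.inverseMetric (fun y ↦ Real.smoothTransition (2 - Kerr.radius 0 y / (8 * M)) * (2 * Kerr.scalarH M 0 y)) (Kerr.nullVector 0)) (fun z ↦ (fun s ↦ 2 * ((1 - 2 * M / s) * ((2 * s - 3 * M) / s ^ 2 - M ^ 3 * (s - 3 * M) ^ 2 / s ^ 6))) (Kerr.radius 0 z)) Φ x μ + 2⁻¹ * (fun s ↦ if s ≤ 7 * M then 2 * (7 * M - s) ^ 2 * (fun ρ ↦ (-((593459 : ℝ) / 10000000)) + (788874 : ℝ) / 10000000 * ρ - (383061 : ℝ) / 10000000 * ρ ^ 2 + (92031 : ℝ) / 10000000 * ρ ^ 3 - (10985 : ℝ) / 10000000 * ρ ^ 4 + (525 : ℝ) / 10000000 * ρ ^ 5) (s / M) / (M ^ 3 * s) else 0) (Kerr.radius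 0 x) * Φ x ^ 2 * (if μ = 0 then (Real.smoothTransition (2 - Kerr.radius 0 x / (8 * M)) * (2 * Kerr.scalarH M 0 x)) else (1 - (Real.smoothTransition (2 - Kerr.radius 0 x / (8 * M)) * (2 * Kerr.scalarH M 0 x))) * x μ / Kerr.radius 0 x) + KerrSchild.multiplierCurrent (KerrSchild.inverseMetric (fun y ↦ Real.smoothTransition (2 - Kerr.radius 0 y / (8 * M)) * (2 * Kerr.scalarH M 0 y)) (Kerr.nullVector 0)) KerrSchild.timeField Φ x μ) := by
  intro M hM
  refine ⟨4, by norm_num, ?_⟩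
  intro ε Φ x hε hx h3
  have hxpos : 0 < Kerr.radius 0 x := by linarith
  have hr0 : Kerr.radius 0 x ≠ 0 := hxpos.ne'
  have hprof : Real.smoothTransition (2 - Kerr.radius 0 x / (8 * M)) * (2 * Kerr.scalarH M 0 x) =
      2 * Kerr.scalarH M 0 x := tailsCut_profile_eq_of_radius_le M 0 x hM (by linarith)
  -- (a) the Killing part has the good sign (dominant energy condition)
  have hT := sum_fderiv_horizonFactor_mul_multiplierCurrent_timeField_nonneg M
    (fun y ↦ Real.smoothTransition (2 - Kerr.radius 0 y / (8 * M)) * (2 * Kerr.scalarH M 0 y)) Φ ε x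
    hM hε hx hprof
  -- the scalars `m = μ(x) = 2M/r`, `s = (r − 2M)/(2M)`, `F = 1 − 3M/r`, `g = ϖ₂/(2f)` and their ranges
  obtain ⟨m, hm⟩ : ∃ m : ℝ, m = 2 * M / Kerr.radius 0 x := ⟨_, rfl⟩
  have hφm : Real.smoothTransition (2 - Kerr.radius 0 x / (8 * M)) * (2 * Kerr.scalarH M 0 x) = m := by
    rw [hprof, hardy_scalarH_zero, hm, mul_div_assoc]
  obtain ⟨s, hs⟩ : ∃ s : ℝ, s = (2 * M)⁻¹ * (Kerr.radius 0 x - 2 * M) := ⟨_, rfl⟩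
  obtain ⟨F, hF⟩ : ∃ F : ℝ, F = 1 - 3 * M / Kerr.radius 0 x := ⟨_, rfl⟩
  obtain ⟨g, hg⟩ : ∃ g : ℝ, g = (2 * Kerr.radius 0 x - 3 * M) / Kerr.radius 0 x ^ 2 -
      M ^ 3 * (Kerr.radius 0 x - 3 * M) ^ 2 / Kerr.radius 0 x ^ 6 := ⟨_, rfl⟩
  have hms : m * s = 1 - m := by
    rw [hm, hs, div_mul_eq_mul_div, mul_inv_cancel_left₀ (by positivity : (2 : ℝ) * M ≠ 0), sub_div,
      div_self hr0]
  have hm0 : 0 ≤ m := by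
    rw [hm]
    positivity
  have hm1 : m ≤ 1 := by
    rw [hm, div_le_one hxpos]
    exact hx.le
  have hs0 : 0 ≤ s := by
    rw [hs]
    exact mul_nonneg (inv_nonneg.2 (by positivity)) (by linarith)
  have hs1 : s ≤ 2⁻¹ := by
    rw [hs]
    calc (2 * M)⁻¹ * (Kerr.radius 0 x - 2 * M) ≤ (2 * M)⁻¹ * M :=
          mul_le_mul_of_nonneg_left (by linarith) (inv_nonneg.2 (by positivity))
      _ = 2⁻¹ := by rw [mul_inv, mul_assoc, inv_mul_cancel₀ hM.ne', mul_one]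
  have hF0 : F ≤ 0 := by
    rw [hF, sub_nonpos, one_le_div hxpos]
    exact h3
  have hF1 : -2⁻¹ ≤ F := by
    have h : 3 * M / Kerr.radius 0 x ≤ 3 / 2 := by
      rw [div_le_iff₀ hxpos]
      linarith
    rw [hF]
    linarith
  have hg1 : 2 * M * g ≤ 1 := by
    have hA : 2 * M * ((2 * Kerr.radius 0 x - 3 * M) / Kerr.radius 0 x ^ 2) ≤ 1 := by
      rw [mul_div_assoc', div_le_one (by positivity)]
      nlinarith [sq_nonneg (Kerr.radius 0 x - 2 * M)]
    have hB : 0 ≤ M ^ 3 * (Kerr.radius 0 x - 3 * M) ^ 2 / Kerr.radius 0 x ^ 6 := by positivity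
    rw [hg, mul_sub]
    linarith [mul_nonneg (by positivity : (0 : ℝ) ≤ 2 * M) hB]
  have hg2 : -1 ≤ 2 * M * g := by
    have hA : 0 ≤ (2 * Kerr.radius 0 x - 3 * M) / Kerr.radius 0 x ^ 2 :=
      div_nonneg (by linarith) (by positivity)
    have hB : 2 * M * (M ^ 3 * (Kerr.radius 0 x - 3 * M) ^ 2 / Kerr.radius 0 x ^ 6) ≤ 1 := by
      rw [mul_div_assoc', div_le_one (by positivity)]
      have h1 : (Kerr.radius 0 x - 3 * M) ^ 2 ≤ M ^ 2 := by
        nlinarith [mul_nonneg (sub_nonneg.2 hx.le) (by linarith : (0 : ℝ) ≤ 4 * M - Kerr.radius 0 x)]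
      have h2 : (2 * M) ^ 6 ≤ Kerr.radius 0 x ^ 6 := pow_le_pow_left₀ (by positivity) hx.le 6
      nlinarith [mul_le_mul_of_nonneg_left h1 (by positivity : (0 : ℝ) ≤ 2 * M * M ^ 3),
        pow_pos hM 6]
    rw [hg, mul_sub]
    linarith [mul_nonneg (by positivity : (0 : ℝ) ≤ 2 * M) hA]
  -- `|x⃗/r| = 1` and the null vector `ℓ♯ = (−1, x⃗/r)`
  have hx2 : x 1 ^ 2 + x 2 ^ 2 + x 3 ^ 2 = Kerr.radius 0 x ^ 2 := by
    rw [Kerr.radius_zero_left, E4.spatialNorm_sq]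
  have hn : (x 1 / Kerr.radius 0 x) ^ 2 + (x 2 / Kerr.radius 0 x) ^ 2 +
      (x 3 / Kerr.radius 0 x) ^ 2 = 1 := by
    rw [div_pow, div_pow, div_pow, ← add_div, ← add_div, hx2, div_self (pow_ne_zero 2 hr0)]
  have hl0 : Kerr.nullVector 0 x 0 = -1 := Kerr.nullVector_apply_zero 0 x
  obtain ⟨hl1, hl2, hl3⟩ := quadDecomp_nullVector_zero_spatial hxpos
  -- the derivative of the horizon factor: `dW = −k (s dt* − dr)`, `k ≥ 0`
  have hrp : Kerr.rPlus M 0 = 2 * M := Kerr.rPlus_zero_right hM.le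
  have hdiff : HasFDerivAt (Kerr.horizonFn M 0) (fderiv ℝ (Kerr.horizonFn M 0) x) x :=
    ((Kerr.contDiffAt_horizonFn M hxpos (n := 1)).differentiableAt (by simp)).hasFDerivAt
  have haff : HasDerivAt (fun u : ℝ ↦ u / ε - 1) (1 / ε) (Kerr.horizonFn M 0 x) :=
    ((hasDerivAt_id _).div_const ε).sub_const 1
  have hd : HasFDerivAt (fun y ↦ Real.smoothTransition (Kerr.horizonFn M 0 y / ε - 1))
      ((deriv Real.smoothTransition (Kerr.horizonFn M 0 x / ε - 1) * (1 / ε)) •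
        fderiv ℝ (Kerr.horizonFn M 0) x) x :=
    ((horizonLayer_hasDerivAt_smoothTransition _).comp _ haff).comp_hasFDerivAt x hdiff
  obtain ⟨k, hk⟩ : ∃ k : ℝ, k = deriv Real.smoothTransition (Kerr.horizonFn M 0 x / ε - 1) *
      (1 / ε) * Real.exp (-((2 * M)⁻¹ * x 0)) := ⟨_, rfl⟩
  have hk0 : 0 ≤ k := by
    rw [hk]
    exact mul_nonneg (mul_nonneg (horizonLayer_deriv_smoothTransition_nonneg _) (by positivity))
      (Real.exp_pos _).le
  have e0 : fderiv ℝ (fun y ↦ Real.smoothTransition (Kerr.horizonFn M 0 y / ε - 1)) x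
      (E4.basisVector 0) = -(k * s) := by
    rw [hd.fderiv, FunLike.coe_smul, Pi.smul_apply, smul_eq_mul,
      Kerr.fderiv_horizonFn_basisVector_zero hxpos, hrp, hk, hs]
    ring
  have es : ∀ i : Fin 3, fderiv ℝ (fun y ↦ Real.smoothTransition (Kerr.horizonFn M 0 y / ε - 1)) x
      (E4.basisVector i.succ) = k * (x i.succ / Kerr.radius 0 x) := by
    intro i
    rw [hd.fderiv, FunLike.coe_smul, Pi.smul_apply, smul_eq_mul,
      Kerr.fderiv_horizonFn_basisVector_succ hxpos, horizonLayer_radiusGradVec_zero hxpos, hk]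
    ring
  have e1 : fderiv ℝ (fun y ↦ Real.smoothTransition (Kerr.horizonFn M 0 y / ε - 1)) x
      (E4.basisVector 1) = k * (x 1 / Kerr.radius 0 x) := es 0
  have e2 : fderiv ℝ (fun y ↦ Real.smoothTransition (Kerr.horizonFn M 0 y / ε - 1)) x
      (E4.basisVector 2) = k * (x 2 / Kerr.radius 0 x) := es 1
  have e3 : fderiv ℝ (fun y ↦ Real.smoothTransition (Kerr.horizonFn M 0 y / ε - 1)) x
      (E4.basisVector 3) = k * (x 3 / Kerr.radius 0 x) := es 2
  -- freeze the explicit fields of the statement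
  generalize (fun s ↦ if s ≤ 7 * M then 2 * (7 * M - s) ^ 2 * (fun ρ ↦ (-((593459 : ℝ) / 10000000)) +
    (788874 : ℝ) / 10000000 * ρ - (383061 : ℝ) / 10000000 * ρ ^ 2 + (92031 : ℝ) / 10000000 * ρ ^ 3 -
    (10985 : ℝ) / 10000000 * ρ ^ 4 + (525 : ℝ) / 10000000 * ρ ^ 5) (s / M) / (M ^ 3 * s) else 0)
    (Kerr.radius 0 x) = Y
  generalize hϖ : (fun z ↦ (fun s ↦ 2 * ((1 - 2 * M / s) * ((2 * s - 3 * M) / s ^ 2 -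
    M ^ 3 * (s - 3 * M) ^ 2 / s ^ 6))) (Kerr.radius 0 z)) = ϖ
  generalize hX : (fun (z : E4) (α : Fin 4) ↦ if α = 0 then (1 - 3 * M / Kerr.radius 0 z) *
    (Real.smoothTransition (2 - Kerr.radius 0 z / (8 * M)) * (2 * Kerr.scalarH M 0 z)) else
    (1 - 3 * M / Kerr.radius 0 z) * (1 - (Real.smoothTransition (2 - Kerr.radius 0 z / (8 * M)) *
    (2 * Kerr.scalarH M 0 z))) * z α / Kerr.radius 0 z) = X
  generalize hφ : (fun y ↦ Real.smoothTransition (2 - Kerr.radius 0 y / (8 * M)) *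
    (2 * Kerr.scalarH M 0 y)) = φ at hT ⊢
  generalize (fun y ↦ Real.smoothTransition (Kerr.horizonFn M 0 y / ε - 1)) = W at e0 e1 e2 e3 hT ⊢
  -- the values of the frozen fields at `x`
  have hφx : φ x = m := by
    rw [← hφ]
    exact hφm
  have hX0 : X x 0 = F * m := by
    rw [← hX]
    simp only [Fin.isValue, if_true, hφm, hF]
  have hX1 : X x 1 = F * (1 - m) * (x 1 / Kerr.radius 0 x) := by
    rw [← hX]
    simp only [Fin.isValue, show (1 : Fin 4) ≠ 0 from by decide, if_false, hφm, hF, mul_div_assoc]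
  have hX2 : X x 2 = F * (1 - m) * (x 2 / Kerr.radius 0 x) := by
    rw [← hX]
    simp only [Fin.isValue, show (2 : Fin 4) ≠ 0 from by decide, if_false, hφm, hF, mul_div_assoc]
  have hX3 : X x 3 = F * (1 - m) * (x 3 / Kerr.radius 0 x) := by
    rw [← hX]
    simp only [Fin.isValue, show (3 : Fin 4) ≠ 0 from by decide, if_false, hφm, hF, mul_div_assoc]
  have hϖx : ϖ x = 2 * ((1 - m) * g) := by
    rw [← hϖ, hm, hg]
  have hϖ0 : fderiv ℝ ϖ x (E4.basisVector 0) = 0 := by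
    rw [← hϖ]
    exact hardy_fderiv_comp_radius_basisVector_zero rfl hxpos
      ((hasDerivAt_morawetzWeight M _ hM hxpos).const_mul 2)
  -- `|∂_μW| ≤ ‖dW‖`, hence `k ≤ 2 ‖dW‖` (`k² = ∑ᵢ (∂ᵢW)²`)
  have hNμ : ∀ μ, |fderiv ℝ W x (E4.basisVector μ)| ≤ ‖fderiv ℝ W x‖ := fun μ ↦ by
    have h := (fderiv ℝ W x).le_opNorm (E4.basisVector μ)
    rwa [Real.norm_eq_abs, horizonLayer_norm_basisVector, mul_one] at h
  have hkN : k ≤ 2 * ‖fderiv ℝ W x‖ := by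
    have h1 := hNμ 1
    have h2 := hNμ 2
    have h3' := hNμ 3
    rw [e1] at h1
    rw [e2] at h2
    rw [e3] at h3'
    have q1 := sq_le_sq' (abs_le.1 h1).1 (abs_le.1 h1).2
    have q2 := sq_le_sq' (abs_le.1 h2).1 (abs_le.1 h2).2
    have q3 := sq_le_sq' (abs_le.1 h3').1 (abs_le.1 h3').2
    have hsum : (k * (x 1 / Kerr.radius 0 x)) ^ 2 + (k * (x 2 / Kerr.radius 0 x)) ^ 2 +
        (k * (x 3 / Kerr.radius 0 x)) ^ 2 = k ^ 2 := by linear_combination k ^ 2 * hn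
    have hk2 : k ^ 2 ≤ (2 * ‖fderiv ℝ W x‖) ^ 2 := by
      rw [← hsum, mul_pow]
      linarith only [q1, q2, q3, sq_nonneg ‖fderiv ℝ W x‖]
    exact (abs_le_of_sq_le_sq' hk2 (by positivity)).2
  -- name the first derivatives of `Φ` and `ϖ₂`
  obtain ⟨p, hp⟩ : ∃ p : Fin 4 → ℝ, ∀ β, fderiv ℝ Φ x (E4.basisVector β) = p β := ⟨_, fun _ ↦ rfl⟩
  obtain ⟨q, hq⟩ : ∃ q : Fin 4 → ℝ, ∀ β, fderiv ℝ ϖ x (E4.basisVector β) = q β := ⟨_, fun _ ↦ rfl⟩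
  have hq0 : q 0 = 0 := by
    rw [← hq]
    exact hϖ0
  have h1Fm : 0 ≤ 1 + F * m := by
    nlinarith only [mul_nonneg (neg_nonneg.2 hF0) (sub_nonneg.2 hm1), hF1]
  -- `μ(x) = m` in the explicit places of the statement
  simp only [hφm]
  -- (b) the exact cancellations and (c) the bound on the remainder
  have key := horizonLayer_sum_eq φ ϖ Φ (Kerr.nullVector 0) X x
    (fun μ ↦ fderiv ℝ W x (E4.basisVector μ)) p q
    (fun μ ↦ if μ = 0 then m else (1 - m) * x μ / Kerr.radius 0 x) (Y := Y) hp hq hq0 hl0 hl1 hl2 hl3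
    hn hφx hms hϖx hX0 hX1 hX2 hX3 (if_pos rfl)
    (by simp only [Fin.isValue, show (1 : Fin 4) ≠ 0 from by decide, if_false, mul_div_assoc])
    (by simp only [Fin.isValue, show (2 : Fin 4) ≠ 0 from by decide, if_false, mul_div_assoc])
    (by simp only [Fin.isValue, show (3 : Fin 4) ≠ 0 from by decide, if_false, mul_div_assoc])
    e0 e1 e2 e3
  have hL0 := horizonLayer_real_bound (p₀ := p 0) (p₁ := p 1) (p₂ := p 2) (p₃ := p 3) (w₀ := Φ x)
    hM hk0 hkN hm0 hm1 hs0 hs1 hF0 hF1 hg1 hg2 hn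
  rw [Fin.sum_univ_four, hp, hp, hp, hp]
  exact (hL0.trans (le_add_of_nonneg_left (mul_nonneg h1Fm hT))).trans_eq key.symm

end Summit.FinalStateConjecture.FinalStateConjecture.Theorems
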